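import Summits.BirchSwinnertonDyer.BirchSwinnertonDyer.Theorems.KolyvaginRoadThreeZhangSupplyEngineOfPoitouTate
import Summits.BirchSwinnertonDyer.BirchSwinnertonDyer.Theorems.KolyvaginRoadThreeMethod2KolyvaginIsoBound
import HarnessLib

/-!
# Route `KolyvaginRoadThree`, deciding crux `ZhangSharpFrameAtThreeHL` (item stmt-BirchSwinnertonDyer-19574):
# S2-ENGINE from the Poitou–Tate named fact ALONE
# (cell `bsd-stepL`, ACCEL seat `bsd-stepL-koly3b` g6; `--supports stmt-BirchSwinnertonDyer-19574`, helper; part XXVII of the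
# `KolyvaginRoadThreeZhangSupply*` series)

HONEST FRAMING. One theorem, pure composition; 0 definitions, 0 named facts, 0 `sorry`; closes nothing (T7) — the crux is
NOT claimed and the stub is NOT booked: the theorem is CONDITIONAL on the named Poitou–Tate fact
`poitouTate_selmerStructure_duality K` (Howard Thm. 2.1.11 ∕ Milne ADT I Thm. 4.10; a Literature `def … : Prop`, unproved in
the tree), taken as the hypothesis `hPT` for imaginary quadratic `K`. PARTITION: O2@3 (B10) × A1 × crux 19574 × stub
S2-ENGINE `stub_inductionOfLevelSystemsAtThree` — proves-glue.

WHAT. Part XXVI's `stub_inductionOfLevelSystemsAtThree_of_poitouTate_of_rigidity (hPT) (hRig)` with the local rigidity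
socket `hRig` DISCHARGED by zhang3-p1 g10's `KolyLocal.sub_zsmul_mem_torsionLocalKer_of_isotropic`
(`Theorems/KolyvaginRoadThreeMethod2KolyvaginIsoBound.lean`: at a Kolyvagin prime the `s`-eigenplane of `H¹(K_λ, E[3])`
is a hyperbolic plane for the Weil cup product, so mutually and self isotropic eigenclasses have proportional
localisations). Result: the registered S2-ENGINE stub text VERBATIM ⟸ `hPT`. The chain behind it (all tree theorems):
stub A (p489918) as hypothesis; koly g14's engine `inductionOfLevelSystems_of_triangulation`; zhang3-p1's
`triangulation_of_supply` ∕ `triangulation_of_kolyvaginLocal` (local Tate package, (Perf), (Line), (Tr-iso)); koly3b's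
(Supply) `hSupply_of_poitouTate` (parts XIII, XVIII–XXV: signed supply from the PT jump over GENUINE Lagrangian ordinary ∕
transverse local conditions + (IsoBound)). [cite: WZhang2014, §9 proof of Thm. 9.1, Lemma 8.2, Lemma 8.4]
[cite: MilneADT2006, Ch. I, Thm. 4.10] [cite: GrossLMS1991, Prop. 8.1–8.2, 9.6] [cite: Howard2004HeegnerKolyvagin, Thm. 2.1.11]
-/

noncomputable section

open scoped Classical Pointwise

namespace Summit.BirchSwinnertonDyer.Rank1Residual.X11b.Three.Koly.ZhangSupply

open CategoryTheory WeierstrassCurve Field Function NumberField IsDedekindDomain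
open Literature.NumberTheory.EllipticCurves Literature.NumberTheory.EllipticCurves.ModularForms
  Literature.NumberTheory.GaloisRepresentations Module
open Literature.NumberTheory.GaloisRepresentations.DiscreteGaloisModule (mu MuCarrier)
open Literature.NumberTheory.GaloisCohomology
open Summit.BirchSwinnertonDyer.Rank1Residual.X11b.Three.Koly.Method2
open Summit.BirchSwinnertonDyer.Rank1Residual.X11b.Three.Koly.Method2.KolyLocal
open Summit.BirchSwinnertonDyer.Rank1Residual.GaloisImage
open scoped ContRepresentation

/-! ## S2-ENGINE from the Poitou–Tate fact ALONE (the local rigidity is zhang3-p1's theorem) -/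

/-- **S2-ENGINE `Method2.stub_inductionOfLevelSystemsAtThree` (skeleton v3 of crux 19574, text VERBATIM as the conclusion)
FROM THE NAMED POITOU–TATE FACT ALONE.** The local line-rigidity socket `hRig` of
`stub_inductionOfLevelSystemsAtThree_of_poitouTate_of_rigidity` is discharged by zhang3-p1 g10's
`KolyLocal.sub_zsmul_mem_torsionLocalKer_of_isotropic` (W. Zhang Lemma 8.4 (1) local input, Gross Prop. 8.1–8.2 ∕ 9.6:
the `s`-eigenplane of `H¹(K_λ, E[3])` is hyperbolic for the Weil cup product). What remains, by name: the hypothesis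
`hPT` = `poitouTate_selmerStructure_duality K` for imaginary quadratic `K` (Howard Thm. 2.1.11 ∕ Milne ADT I Thm. 4.10;
Literature named fact, unproved in the tree). CONDITIONAL on `hPT`; nothing is booked.
[cite: WZhang2014, §9 proof of Thm. 9.1, Lemma 8.2, Lemma 8.4] [cite: MilneADT2006, Ch. I, Thm. 4.10]
[cite: GrossLMS1991, Prop. 8.1–8.2, 9.6] [cite: Howard2004HeegnerKolyvagin, Thm. 2.1.11] -/
theorem stub_inductionOfLevelSystemsAtThree_of_poitouTate
    (hPT : ∀ (K : Type) [Field K] [NumberField K], IsImaginaryQuadratic K → poitouTate_selmerStructure_duality K) :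
    ∀ (W : WeierstrassCurve ℚ) [W.IsElliptic] [W.IsGloballyMinimal] [NeZero (W.conductorNorm ℤ)] (K : Type)
      [Field K] [NumberField K] (Dt : ModularParametrizationData W (W.conductorNorm ℤ)) (β : ℤ) (ι : K →+* ℂ),
      Summit.BirchSwinnertonDyer.Rank1Residual.ClassX11b W 3 → W.HasMultiplicativeReductionAtPrime 3 →
      Rank1Residual.Surj W 3 → Rank1Residual.Ram W 3 → ¬ 3 ∣ W.tamagawaProduct → IsImaginaryQuadratic K →
      Odd (NumberField.discr K) → SatisfiesHeegnerHypothesis (W.conductorNorm ℤ) K →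
      (W.quadraticTwist (NumberField.discr K : ℚ)).entireLFunction 1 ≠ 0 → NumberField.discr K ≠ -3 →
      (4 * (W.conductorNorm ℤ : ℤ)) ∣ β ^ 2 - NumberField.discr K → ¬ (3 : ℤ) ∣ Dt.c →
      ∀ (c : K ≃ₐ[ℚ] K), c ≠ 1 → ∀ [Module (ZMod 3) (V3 W K)],
      LevelKolyvaginSystem W K Dt β ι c →
      -- (A1) at the frame (stub A's body, verbatim) as HYPOTHESIS
      (∀ (n : Finset {q // IsUAdmissiblePrime W K q}) (μ : Bool) (x : V3 W K),
        GoodLevel W K n → x ∈ SelQ W K c n μ → x ≠ 0 →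
        ∃ q : {q // IsUAdmissiblePrime W K q}, q ∉ n ∧ GoodLevel W K (insert q n) ∧
          x ∉ SelQ W K c (insert q n) μ ∧
          SelQ W K c (insert q n) μ ≤ SelQ W K c n μ ∧
          finrank (ZMod 3) (SelQ W K c (insert q n) μ) + 1 = finrank (ZMod 3) (SelQ W K c n μ) ∧
          SelQ W K c (insert q n) (!μ) = SelQ W K c n (!μ)) →
      Odd (finrank (ZMod 3)
        (AddSubgroup.toZModSubmodule 3 (selmerGroup (W.baseChange K) ((3 ^ 1 : ℕ) : ℤ)))) →
      3 ≤ finrank (ZMod 3)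
        (AddSubgroup.toZModSubmodule 3 (selmerGroup (W.baseChange K) ((3 ^ 1 : ℕ) : ℤ))) →
      ∃ (n : ℕ) (d : KolyvaginHeegnerData Dt β ι n),
        KolyvaginDescent.KolSupp (Zhang2014.IsKolyvaginPrime (W.conductorNorm ℤ) W K 3) n ∧
          d.kolyvaginClass Nat.prime_three 1 ≠ 0 := by
  refine stub_inductionOfLevelSystemsAtThree_of_poitouTate_of_rigidity hPT ?_
  intro W _ _ K _ _ hK hsurj c hc e hμ hadd₁ hadd₂ halt hnondeg hgal ℓ hℓ v hv s x y hxs hys h11 h12 h21 h22 hx0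
  exact KolyLocal.sub_zsmul_mem_torsionLocalKer_of_isotropic W K hK hsurj hc e hμ hadd₁ hadd₂ halt hnondeg hgal hℓ v
    hv s hxs hys h11 h12 h21 h22 hx0


end Summit.BirchSwinnertonDyer.Rank1Residual.X11b.Three.Koly.ZhangSupply

end
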